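import Summits.BirchSwinnertonDyer.BirchSwinnertonDyer.Theorems.InertBadSignedBranchesInertBadAtThreeIstarZeroEtaMCPair
import Summits.BirchSwinnertonDyer.BirchSwinnertonDyer.Theorems.InertBadSignedBranchesInertBadAtThreeIstarZeroPeriodRatioOfMazur
import Summits.BirchSwinnertonDyer.BirchSwinnertonDyer.Theorems.InertBadSignedBranchesInertBadAtThreeIstarZeroOddHeadsOfLiterature
import Summits.BirchSwinnertonDyer.Rank1Residual.Additive.QuadraticBranchTamagawaAtOddPrime
import HarnessLib

/-!
# Route `InertBadSignedBranches` (rung K8), D71 child `InertBadAtThreeIstarZero` — the child MODULO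
# the law at `3`, Kobayashi's even main conjecture at `η` for CM curves (ONE verbatim form), two
# NAMED Literature facts and `PublishedFactsInert`; the `ℚ(√p*)`-form of (C1_η) ELIMINATED
# (file 2/2; helper `--supports stmt-BirchSwinnertonDyer-19656`; cell `bsd-cm`, seat `bsd-cm-k8i-c41`
# gen 2; theorems only, nothing asserted)

HONEST FRAMING (cell `bsd-cm`, `run/shared/lean/pub/bsd-cm/`): Birch–Swinnerton-Dyer is NOT proved
by any of this. The item — the `3`-part of BSD for every globally minimal CM curve of signed local
type `(3, I₀*)` and analytic rank one (O10-PS@3, 57 classes `N < 5·10⁵`) — is OPEN in print (the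
η-branch `3`-adic Gross–Zagier law; Pan 2017 unpublished, Tian ICM 2022 p. 1993 attribution only).
Every theorem is CONDITIONAL on displayed hypotheses; 0 definitions, 0 named facts, 0 `sorry`;
nothing booked, no label moves.

PARTITION (D-0054): CornerF inert-bad (B12 / O10) × O10-PS@3 (57 classes; §1: O10-PS at every odd
`p`) × `p` inert — types-the-object-of; closes no cell.

## What is here

* §1 (any odd `p`) — `missingInputAt_IstarZero_of_pairLaw_of_exactReading_of_ne_two`: the typed
  missing input on the type ⟸ the law in pair form ∧ (R2) on the type ∧ the `h1`-FREE exact reading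
  on the type ∧ `hmod hGZ hGZK hPT hnf` ∧ `hper` ∧ `ord_p c_p = 0` (bsd-cm-inert's
  `…_of_pairLaw_of_readings_of_ne_two`, p410975, WITHOUT its `hC1`); and
  `missingInputAt_IstarZero_of_pairLaw_of_kobayashi74_of_plusMCEtaK_of_ne_two`: the same with the
  readings supplied BY NAME and `ord_p c_p = 0` PROVED — (R2) from `KitajimaOtsuki2018.mainThm13_…`,
  the exact reading from `Kobayashi2003.thm74_etaEvenMC_iff_etaOddMC` + `hC1K` (Kobayashi's even
  main conjecture at `η` for CM `V`, VERBATIM §4 p. 8 — Pollack–Rubin's p. 448 REMARK for CM, the ONE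
  conjecture-grade reading input, carried) — and `hper` from Mazur's `p ∤ c₀`
  (`InertBadOdd.periodRatio_of_mazur_of_ne_two`, x1b p415251). Serves the `p ≥ 5` cone verbatim.
* §2 (`p = 3`) — THE CHILD (fully-qualified route type) ⟸ C-cc-1@3 (pair/LEVEL form) ∧ `hC1K₃` ∧
  the two named facts ∧ `PublishedFactsInert` (`ord₃ c₃(W) = 0` discharged by
  `InertBadOdd.padicValNat_localTamagawaNumber_eq_zero_of_hasCM_three`); and the (GZ_η-VAL)@3
  (print/LOG) twin. Compared with gen 0 (p418040: law ∧ (C1_η)@3 ∧ `hKO₃` ∧ `h74X₃` ∧ facts) and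
  this seat's p421489 (law ∧ (C1_η)@3 in TWO forms ∧ named facts ∧ facts): the displayed non-print
  inputs are now exactly TWO — the law at `3` (the crux content) and Kobayashi's even main
  conjecture at `η` for CM curves at `p = 3` in its own printed form. The `ℚ(√p*)`-subtower form
  `Additive.QuadraticBranchPlusMainConjectureAt` and its reading flag `Kob03-MC-eta-quadratic-subtower`
  are no longer in the cone of the child (nor, by §1, needed in the `p ≥ 5` cone).

References: [Kobayashi2003] §4, Thm. 7.4, Thm. 9.3; [KitajimaOtsuki2018] Thm. 1.3; [PollackRubin2004]
p. 448; [Mazur1978] Cor. 4.1; [SilvermanAEC2009] IV.6.4, VII.6.3; [Miller2011LMS] Def. 1.1.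
-/

set_option autoImplicit false
set_option linter.dupNamespace false

noncomputable section
open scoped Classical NumberField
open CongruenceSubgroup Field Function NumberField IsDedekindDomain IsDedekindDomain.HeightOneSpectrum
  WeierstrassCurve Rat.HeightOneSpectrum
open Literature.NumberTheory.EllipticCurves
open Literature.NumberTheory.EllipticCurves.ModularForms
open Literature.NumberTheory.EllipticCurves.Rank1Residual
open Literature.NumberTheory.EllipticCurves.Rank1Residual.Typed
open Literature.NumberTheory.GaloisRepresentations
open Literature.NumberTheory.GaloisCohomology
open ZpExtension
open Summit.BirchSwinnertonDyer.Rank1Residual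
open Summit.BirchSwinnertonDyer.Rank1Residual.Additive
open Summit.BirchSwinnertonDyer.Rank1Residual.Additive.LocalLog
open Summit.BirchSwinnertonDyer.Rank1Residual.X12
open Summit.BirchSwinnertonDyer.Rank1Residual.X12.O10
open Summit.BirchSwinnertonDyer.BirchSwinnertonDyer.Theses.InertBadSignedBranches
open Summit.BirchSwinnertonDyer.BirchSwinnertonDyer.Theorems.InertBadOdd
open Summit.BirchSwinnertonDyer.BirchSwinnertonDyer.Theorems.EtaGZ
open Summit.BirchSwinnertonDyer.BirchSwinnertonDyer.Theorems.PrintReadingsOfLiterature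

namespace Summit.BirchSwinnertonDyer.BirchSwinnertonDyer.Theorems.InertBadOddEta

variable (p : ℕ) [hp : Fact p.Prime]

/-! ## §1 The typed missing input on `(p, I₀*)` at any odd `p`, `h1`-free -/

/-- **THE TYPED MISSING INPUT ON THE SIGNED TYPE `(p, I₀*)` AT ANY ODD `p`, WITHOUT (C1_η) in
`ℚ(√p*)`-form** — `∀ W` of signed local type `(p, I₀*)` with `r_an(W) = 1`, `X12.MissingInputAt W p`
— ⟸ the law in pair form on the type (`hlaw`) ∧ (R2) on the type (`hR2`) ∧ the `h1`-free exact
reading on the type (`hX`) ∧ `hmod hGZ hGZK hPT hnf` ∧ `hper` ∧ `ord_p c_p = 0` on the type.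
bsd-cm-inert's `InertBadOdd.missingInputAt_IstarZero_of_pairLaw_of_readings_of_ne_two` with `hC1`
REMOVED (file 1/2 supplies the `h1`-free pair links). CONDITIONAL; nothing booked.
[cite: Kobayashi2003, §4 (p. 8), Thm. 7.4 (p. 13)] [cite: KitajimaOtsuki2018, Main Thm. 1.3]
[cite: Miller2011LMS, §1 and Def. 1.1] -/
theorem missingInputAt_IstarZero_of_pairLaw_of_exactReading_of_ne_two
    (hmod : hasEntireLFunction_rat) (hGZ : GrossZagier1986_thm_I_7_3)
    (hGZK : rank_eq_analyticRank_of_analyticRank_le_one)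
    (hPT : poitouTate_selmerStructure_duality_real ℚ) (hnf : exists_isNewformOf)
    (hper : ∀ (V : WeierstrassCurve ℚ) [V.IsElliptic] [V.IsGloballyMinimal]
      {N : ℕ} [NeZero N] (f : CuspForm (Gamma0 N) 2), IsNewformOf V f →
      V.HasGoodReductionAtPrime p → V.frobeniusTrace p = 0 →
      ∃ ϖ : ℚ, ‖(ϖ : ℚ_[p])‖ ≤ 1 ∧
        (if Even (p / 2) then (ϖ : ℝ) * V.realPeriodRat = plusPeriod f
          else (ϖ : ℝ) * V.imaginaryPeriodRat = minusPeriod f))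
    (hlaw : ∀ (W : WeierstrassCurve ℚ) [W.IsElliptic] [W.IsGloballyMinimal],
      HasSignedLocalType W p (.Istar 0) → W.analyticRank = 1 →
      ∀ (V : WeierstrassCurve ℚ) [V.IsElliptic] [V.IsGloballyMinimal] (C : VariableChange ℚ)
        {N : ℕ} [NeZero N] {f : CuspForm (Gamma0 N) 2},
        C • W.quadraticTwist ((-1) ^ (p / 2) * p) = V →
        V.HasGoodReductionAtPrime p → V.frobeniusTrace p = 0 → IsNewformOf V f →
        ∀ (ϖ : ℚ), (if Even (p / 2) then (ϖ : ℝ) * V.realPeriodRat = plusPeriod f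
            else (ϖ : ℝ) * V.imaginaryPeriodRat = minusPeriod f) →
        ∀ (L : IwasawaAlgebra p), IsQuadraticBranchMinusLFunction f p ϖ L →
        (∀ Q : (W.baseChange ℚ_[p]).toAffine.Point, p • Q = 0 → Q = 0) →
        ∀ (P : W.toAffine.Point) (n : ℕ), ¬ IsOfFinAddOrder P →
        (∀ R : W.toAffine.Point, ∃ (k : ℤ) (T : W.toAffine.Point), IsOfFinAddOrder T ∧ R = k • P + T) →
        (∃ Q : (W.baseChange ℚ_[p]).toAffine.Point, p ^ n • Q = W.toPadicPoint p P) →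
        (∀ Q : (W.baseChange ℚ_[p]).toAffine.Point, p ^ (n + 1) • Q ≠ W.toPadicPoint p P) →
        ∀ (q : ℚ), shaAn W = (q : ℂ) →
        PowerSeries.coeff 1 L ≠ 0 ∧
          ((PowerSeries.coeff 1 L : ℤ_[p]) : ℚ_[p]).valuation =
            2 * (n : ℤ) + padicValRat p (q * W.tamagawaProduct / (W.torsionOrder : ℚ) ^ 2))
    (hR2 : ∀ (W : WeierstrassCurve ℚ) [W.IsElliptic] [W.IsGloballyMinimal],
      HasSignedLocalType W p (.Istar 0) → W.analyticRank = 1 →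
      OddBranchStrictMinusNoFiniteSubmoduleAt W p)
    (hX : ∀ (W : WeierstrassCurve ℚ) [W.IsElliptic] [W.IsGloballyMinimal],
      HasSignedLocalType W p (.Istar 0) → W.analyticRank = 1 →
      ∀ (V : WeierstrassCurve ℚ) [V.IsElliptic] [V.IsGloballyMinimal] (C : VariableChange ℚ)
        {N : ℕ} [NeZero N] {f : CuspForm (Gamma0 N) 2},
        p ≠ 2 → C • W.quadraticTwist ((-1) ^ (p / 2) * p) = V →
        V.HasGoodReductionAtPrime p → V.frobeniusTrace p = 0 → IsNewformOf V f →
        ∀ (ϖ : ℚ), (if Even (p / 2) then (ϖ : ℝ) * V.realPeriodRat = plusPeriod f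
            else (ϖ : ℝ) * V.imaginaryPeriodRat = minusPeriod f) →
        ∀ (Lη : IwasawaAlgebra p), IsQuadraticBranchMinusLFunction f p ϖ Lη →
        ∀ (κ : ZpExtension ℚ p) (γ : Field.absoluteGaloisGroup ℚ),
          κ.IsCyclotomic → κ.IsTopGenerator γ → IsCyclotomicVariable p γ →
        ∀ (D : StrictSignedSelmerDualData W κ ℚ_[p] γ (-1)) (L' : IwasawaAlgebra p),
          Lη = PowerSeries.X * L' → D.charIdeal = Ideal.span {L'})
    (hcp : ∀ (W : WeierstrassCurve ℚ) [W.IsElliptic] [W.IsGloballyMinimal],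
      HasSignedLocalType W p (.Istar 0) →
      padicValNat p ((W.baseChange (((primesEquiv (R := 𝓞 ℚ)).symm ⟨p, hp.out⟩).adicCompletion ℚ)).localTamagawaNumber
        (((primesEquiv (R := 𝓞 ℚ)).symm ⟨p, hp.out⟩).adicCompletionIntegers ℚ)) = 0)
    (hp2 : p ≠ 2) :
    ∀ (W : WeierstrassCurve ℚ) [W.IsElliptic] [W.IsGloballyMinimal],
      HasSignedLocalType W p (.Istar 0) → W.analyticRank = 1 → X12.MissingInputAt W p := by
  -- adapted from InertBadOdd.missingInputAt_IstarZero_of_pairLaw_of_readings_of_ne_two: `hC1` dropped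
  intro W _ _ hT hr
  have hB : BSDp W p := pairData_elim_of_ne_two W hGZK hnf hper hT hr hp2
    fun V _ _ C _ _ _ ϖ L P n hC hgood hap _hCM _hin hf hϖ hL htors hP hgen hdiv hndiv ↦
      bsdp_of_pairValuation_of_exactReading_of_ne_two W hmod hGZ hGZK hPT (hR2 W hT hr) (hX W hT hr)
        (hlaw W hT hr V C hC hgood hap hf ϖ hϖ L hL htors P n hP hgen hdiv hndiv)
        hp2 (hcp W hT) hC hgood hap hf hϖ hL htors hP hgen hdiv hndiv hr
  haveI : Finite W.sha := (hGZK W (by rw [hr])).2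
  exact fun _ ↦ missingPPartAt_of_bsdp W p hB

/-- **THE TYPED MISSING INPUT ON `(p, I₀*)` AT ANY ODD `p` ⟸ the law in pair form ∧ Kobayashi's even
main conjecture at `η` for CM curves in its OWN form (`hC1K`) ∧ the NAMED facts Kitajima–Otsuki
Main Thm. 1.3, Kobayashi Thm. 7.4 (η), Mazur's `p ∤ c₀` ∧ `hmod hGZ hGZK hPT hnf`.** (R2) BY NAME
(`PrintReadingsOfLiterature.oddBranchStrictMinusNoFiniteSubmoduleAt_of_kitajimaOtsuki`), the exact
reading BY NAME + `hC1K` (file 1/2), `hper` BY NAME from Mazur (`InertBadOdd.periodRatio_of_mazur_of_ne_two`),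
`ord_p c_p(W) = 0` PROVED on the type (x1b: `c_p ∈ {1, 2, 4}` for the `p*`-twist of a good curve,
`padicValNat_localTamagawaNumber_eq_zero_of_quadraticTwist_signedPrime_of_odd`). The `p`-generic node
serving both the `p ≥ 5` cone and the `p = 3` child (§2). CONDITIONAL.
[cite: Kobayashi2003, §4 (p. 8), Thm. 7.4 (p. 13)] [cite: KitajimaOtsuki2018, Main Thm. 1.3]
[cite: PollackRubin2004, p. 448 (remark)] [cite: Mazur1978, Cor. 4.1] [cite: Miller2011LMS, Def. 1.1] -/
theorem missingInputAt_IstarZero_of_pairLaw_of_kobayashi74_of_plusMCEtaK_of_ne_two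
    (hmod : hasEntireLFunction_rat) (hGZ : GrossZagier1986_thm_I_7_3)
    (hGZK : rank_eq_analyticRank_of_analyticRank_le_one)
    (hPT : poitouTate_selmerStructure_duality_real ℚ) (hnf : exists_isNewformOf)
    (hM : mazur_not_dvd_maninConstant_of_odd)
    (hKO : KitajimaOtsuki2018.mainThm13_etaSignedSelmerDual_noFiniteSubmodule)
    (h74 : Kobayashi2003.thm74_etaEvenMC_iff_etaOddMC)
    (hC1K : ∀ (K₀ : Type) [Field K₀] [NumberField K₀] [IsCyclotomicExtension {p} ℚ K₀]
        [(galRange (K := ℚ) K₀).Normal] (ηχ : absoluteGaloisGroup ℚ →* ℤˣ),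
        (∀ σ ∈ galRange (K := ℚ) K₀, ηχ σ = 1) → ηχ ≠ 1 →
      ∀ (V : WeierstrassCurve ℚ) [V.IsElliptic] [V.IsGloballyMinimal] {N : ℕ} [NeZero N]
        {f : CuspForm (Gamma0 N) 2}, V.HasCM →
        p ≠ 2 → V.HasGoodReductionAtPrime p → V.frobeniusTrace p = 0 → IsNewformOf V f →
      ∀ (ϖ : ℚ), (if Even (p / 2) then (ϖ : ℝ) * V.realPeriodRat = plusPeriod f
          else (ϖ : ℝ) * V.imaginaryPeriodRat = minusPeriod f) →
      ∀ (κ : ZpExtension ℚ p) (γ : absoluteGaloisGroup ℚ),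
        κ.IsCyclotomic → κ.IsTopGenerator γ → γ ∈ galRange (K := ℚ) K₀ → IsCyclotomicVariable p γ →
      ∀ (Lp : IwasawaAlgebra p), Additive.IsQuadraticBranchPlusLFunction f p ϖ Lp →
      ∀ D : Additive.EtaSignedSelmerDualData V κ K₀ ℚ_[p] ηχ γ 1,
        D.charIdeal = Ideal.span {Lp})
    (hlaw : ∀ (W : WeierstrassCurve ℚ) [W.IsElliptic] [W.IsGloballyMinimal],
      HasSignedLocalType W p (.Istar 0) → W.analyticRank = 1 →
      ∀ (V : WeierstrassCurve ℚ) [V.IsElliptic] [V.IsGloballyMinimal] (C : VariableChange ℚ)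
        {N : ℕ} [NeZero N] {f : CuspForm (Gamma0 N) 2},
        C • W.quadraticTwist ((-1) ^ (p / 2) * p) = V →
        V.HasGoodReductionAtPrime p → V.frobeniusTrace p = 0 → IsNewformOf V f →
        ∀ (ϖ : ℚ), (if Even (p / 2) then (ϖ : ℝ) * V.realPeriodRat = plusPeriod f
            else (ϖ : ℝ) * V.imaginaryPeriodRat = minusPeriod f) →
        ∀ (L : IwasawaAlgebra p), IsQuadraticBranchMinusLFunction f p ϖ L →
        (∀ Q : (W.baseChange ℚ_[p]).toAffine.Point, p • Q = 0 → Q = 0) →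
        ∀ (P : W.toAffine.Point) (n : ℕ), ¬ IsOfFinAddOrder P →
        (∀ R : W.toAffine.Point, ∃ (k : ℤ) (T : W.toAffine.Point), IsOfFinAddOrder T ∧ R = k • P + T) →
        (∃ Q : (W.baseChange ℚ_[p]).toAffine.Point, p ^ n • Q = W.toPadicPoint p P) →
        (∀ Q : (W.baseChange ℚ_[p]).toAffine.Point, p ^ (n + 1) • Q ≠ W.toPadicPoint p P) →
        ∀ (q : ℚ), shaAn W = (q : ℂ) →
        PowerSeries.coeff 1 L ≠ 0 ∧
          ((PowerSeries.coeff 1 L : ℤ_[p]) : ℚ_[p]).valuation =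
            2 * (n : ℤ) + padicValRat p (q * W.tamagawaProduct / (W.torsionOrder : ℚ) ^ 2))
    (hp2 : p ≠ 2) :
    ∀ (W : WeierstrassCurve ℚ) [W.IsElliptic] [W.IsGloballyMinimal],
      HasSignedLocalType W p (.Istar 0) → W.analyticRank = 1 → X12.MissingInputAt W p := by
  refine missingInputAt_IstarZero_of_pairLaw_of_exactReading_of_ne_two p hmod hGZ hGZK hPT hnf
    (periodRatio_of_mazur_of_ne_two p hM hp2) hlaw
    (fun W _ _ _ _ ↦ oddBranchStrictMinusNoFiniteSubmoduleAt_of_kitajimaOtsuki W p hKO)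
    (fun _ _ _ hT _ ↦ exactReadingAt_of_kobayashi74_of_plusMCEtaK p hp2 h74 hC1K hT) (fun W _ _ hT ↦ ?_) hp2
  -- `ord_p c_p(W) = 0` on the type at every odd `p` (x1b: `c_p ∈ {1, 2, 4}` for the `p*`-twist of a good curve)
  obtain ⟨V, _, _, C, hC, hgood, -⟩ := exists_goodTwist_pStar_of_hasSignedLocalType_IstarZero_of_ne_two W hT hp2
  exact padicValNat_localTamagawaNumber_eq_zero_of_quadraticTwist_signedPrime_of_odd W p hp2 C V hC hgood

/-! ## §2 The `p = 3` child -/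

/-- **THE D71 CHILD `InertBadAtThreeIstarZero` MODULO C-cc-1@3 (pair/LEVEL normal form) ∧ Kobayashi's
even main conjecture at `η` for CM curves at `p = 3` (`hC1K₃`, ONE verbatim form) ∧ the NAMED facts
Kitajima–Otsuki 2018 Main Thm. 1.3 and Kobayashi 2003 Thm. 7.4 (η) ∧ the route's support item
`PublishedFactsInert`.** `hlaw₃` = the crux `CccOneLawOnTypeIstarZero`'s unfolded body READ AT `3` in
the `+ δ`-free normal form of record (NIT-K8P3-2) — the ONE input with no print behind it; `hC1K₃` =
VERBATIM Kobayashi §4 p. 8 "`Char(X⁺(E/K_∞)^η) = (L_p⁺(E, η, X))`" for CM `V` good at `3` with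
`a₃(V) = 0` (= Pollack–Rubin's p. 448 remark for CM, `p > 2`; conjecture-grade, carried; period
clause read at `p* = −3`: imaginary period); `h₆` = `PublishedFactsInert` (entire `L`, GZ I.7.3,
GZK, Poitou–Tate, modularity, Mazur — `hper`@3 from its Mazur conjunct; `ord₃ c₃(W) = 0` is proved
in §1). The `ℚ(√−3)`-form (C1_η)@3
of gen 0 / p421489 is GONE. CONDITIONAL on every displayed hypothesis; the item stays OPEN; nothing
booked. [cite: Kobayashi2003, §4 (p. 8), Thm. 7.4 (p. 13)] [cite: KitajimaOtsuki2018, Main Thm. 1.3]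
[cite: PollackRubin2004, p. 448 (remark)] [cite: Mazur1978, Cor. 4.1]
[cite: SilvermanATAEC1994, IV.9.4 and Table 4.1] [cite: Miller2011LMS, §1 and Def. 1.1] -/
theorem inertBadAtThreeIstarZero_of_pairLawAtThree_of_kobayashi74_of_plusMCEtaK
    (hlaw₃ : ∀ (W : WeierstrassCurve ℚ) [W.IsElliptic] [W.IsGloballyMinimal],
      HasSignedLocalType W 3 (.Istar 0) → W.analyticRank = 1 →
      ∀ (V : WeierstrassCurve ℚ) [V.IsElliptic] [V.IsGloballyMinimal] (C : VariableChange ℚ)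
        {N : ℕ} [NeZero N] {f : CuspForm (Gamma0 N) 2},
        C • W.quadraticTwist (-3) = V →
        V.HasGoodReductionAtPrime 3 → V.frobeniusTrace 3 = 0 → IsNewformOf V f →
        ∀ (ϖ : ℚ), (ϖ : ℝ) * V.imaginaryPeriodRat = minusPeriod f →
        ∀ (L : IwasawaAlgebra 3), IsQuadraticBranchMinusLFunction f 3 ϖ L →
        (∀ Q : (W.baseChange ℚ_[3]).toAffine.Point, 3 • Q = 0 → Q = 0) →
        ∀ (P : W.toAffine.Point) (n : ℕ), ¬ IsOfFinAddOrder P →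
        (∀ R : W.toAffine.Point, ∃ (k : ℤ) (T : W.toAffine.Point), IsOfFinAddOrder T ∧ R = k • P + T) →
        (∃ Q : (W.baseChange ℚ_[3]).toAffine.Point, 3 ^ n • Q = W.toPadicPoint 3 P) →
        (∀ Q : (W.baseChange ℚ_[3]).toAffine.Point, 3 ^ (n + 1) • Q ≠ W.toPadicPoint 3 P) →
        ∀ (q : ℚ), shaAn W = (q : ℂ) →
        PowerSeries.coeff 1 L ≠ 0 ∧
          ((PowerSeries.coeff 1 L : ℤ_[3]) : ℚ_[3]).valuation =
            2 * (n : ℤ) + padicValRat 3 (q * W.tamagawaProduct / (W.torsionOrder : ℚ) ^ 2))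
    (hC1K₃ : ∀ (K₀ : Type) [Field K₀] [NumberField K₀] [IsCyclotomicExtension {3} ℚ K₀]
        [(galRange (K := ℚ) K₀).Normal] (ηχ : absoluteGaloisGroup ℚ →* ℤˣ),
        (∀ σ ∈ galRange (K := ℚ) K₀, ηχ σ = 1) → ηχ ≠ 1 →
      ∀ (V : WeierstrassCurve ℚ) [V.IsElliptic] [V.IsGloballyMinimal] {N : ℕ} [NeZero N]
        {f : CuspForm (Gamma0 N) 2}, V.HasCM →
        (3 : ℕ) ≠ 2 → V.HasGoodReductionAtPrime 3 → V.frobeniusTrace 3 = 0 → IsNewformOf V f →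
      ∀ (ϖ : ℚ), (ϖ : ℝ) * V.imaginaryPeriodRat = minusPeriod f →
      ∀ (κ : ZpExtension ℚ 3) (γ : absoluteGaloisGroup ℚ),
        κ.IsCyclotomic → κ.IsTopGenerator γ → γ ∈ galRange (K := ℚ) K₀ → IsCyclotomicVariable 3 γ →
      ∀ (Lp : IwasawaAlgebra 3), Additive.IsQuadraticBranchPlusLFunction f 3 ϖ Lp →
      ∀ D : Additive.EtaSignedSelmerDualData V κ K₀ ℚ_[3] ηχ γ 1, D.charIdeal = Ideal.span {Lp})
    (hKO : KitajimaOtsuki2018.mainThm13_etaSignedSelmerDual_noFiniteSubmodule)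
    (h74 : Kobayashi2003.thm74_etaEvenMC_iff_etaOddMC) (h₆ : PublishedFactsInert) :
    Summit.BirchSwinnertonDyer.BirchSwinnertonDyer.Theses.InertBadSignedBranches.InertBadAtThreeIstarZero := by
  unfold Summit.BirchSwinnertonDyer.BirchSwinnertonDyer.Theses.InertBadSignedBranches.InertBadAtThreeIstarZero
  obtain ⟨hmod, hGZ, hGZK, hPT, hnf, hM⟩ := h₆
  have h32 : ((-1 : ℚ) ^ (3 / 2) * (3 : ℕ)) = -3 := by norm_num
  have hodd : ¬ Even (3 / 2) := by decide
  intro W _ _ _ hT hr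
  refine missingInputAt_IstarZero_of_pairLaw_of_kobayashi74_of_plusMCEtaK_of_ne_two 3 hmod hGZ hGZK hPT
    hnf hM hKO h74 ?_ ?_ (by decide) W hT hr
  · intro K₀ _ _ _ _ ηχ hηK hη1 V _ _ N _ f hCM hp2 hgood hap hf ϖ hϖ κ γ hκ hγ hγK hγc Lp hLp D
    rw [if_neg hodd] at hϖ
    exact hC1K₃ K₀ ηχ hηK hη1 V hCM hp2 hgood hap hf ϖ hϖ κ γ hκ hγ hγK hγc Lp hLp D
  · intro W _ _ hT hr V _ _ C N _ f hC hgood hap hf ϖ hϖ L hL htors P n hP hgen hdiv hndiv q hq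
    rw [h32] at hC
    rw [if_neg hodd] at hϖ
    exact hlaw₃ W hT hr V C hC hgood hap hf ϖ hϖ L hL htors P n hP hgen hdiv hndiv q hq

/-! ## §3 The print/LOG currency: (GZ_η-VAL) ⟹ the pair/LEVEL law, and the child's twin -/

/-- **Law-level conversion at any odd `p`: (GZ_η-VAL) in print/LOG currency ⟹ C-cc-1 in pair/LEVEL
form on the type** (`v_p log_ω(P) = n` at `p`-divisibility level `n` when `W` is additive at `p`,
`ord_p c_p(W ⊗ ℚ_p) = 0` and `W(ℚ_p)[p] = 0` — `EtaGZ.valuation_padicLog_eq_level`; the analytic sides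
matched by `leadingTerm_eq_of_shaAn_eq`). bsd-cm-inert's inline step of
`InertBadOdd.missingInputAt_IstarZero_of_etaGZValuation_of_readings_of_ne_two`, isolated (no readings,
no (C1_η)). CONDITIONAL on `hcp`. [cite: SilvermanAEC2009, IV.6.4 and VII.6.3]
[cite: Kobayashi2003, §4 (p. 8)] [cite: Miller2011LMS, §1 and Def. 1.1] -/
theorem pairLaw_of_etaGZValuation_of_ne_two
    (hGZ : ∀ (W : WeierstrassCurve ℚ) [W.IsElliptic] [W.IsGloballyMinimal],
      HasSignedLocalType W p (.Istar 0) → W.analyticRank = 1 →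
      ∀ (V : WeierstrassCurve ℚ) [V.IsElliptic] [V.IsGloballyMinimal] (C : VariableChange ℚ)
        {N : ℕ} [NeZero N] {f : CuspForm (Gamma0 N) 2},
        C • W.quadraticTwist ((-1) ^ (p / 2) * p) = V →
        V.HasGoodReductionAtPrime p → V.frobeniusTrace p = 0 → IsNewformOf V f →
        ∀ (ϖ : ℚ), (if Even (p / 2) then (ϖ : ℝ) * V.realPeriodRat = plusPeriod f
            else (ϖ : ℝ) * V.imaginaryPeriodRat = minusPeriod f) →
        ∀ (L : IwasawaAlgebra p), IsQuadraticBranchMinusLFunction f p ϖ L →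
        ∀ (P : W.toAffine.Point), ¬ IsOfFinAddOrder P →
        (∀ R : W.toAffine.Point, ∃ (k : ℤ) (T : W.toAffine.Point), IsOfFinAddOrder T ∧ R = k • P + T) →
        ∀ (q : ℚ), W.leadingLCoeff / ((W.realPeriodRat * W.regulator : ℝ) : ℂ) = (q : ℂ) →
        PowerSeries.coeff 1 L ≠ 0 ∧
          ((PowerSeries.coeff 1 L : ℤ_[p]) : ℚ_[p]).valuation =
            2 * (padicLog (W.baseChange ℚ_[p]) (W.toPadicPoint p P)).valuation + padicValRat p q)
    (hcp : ∀ (W : WeierstrassCurve ℚ) [W.IsElliptic] [W.IsGloballyMinimal],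
      HasSignedLocalType W p (.Istar 0) →
      padicValNat p ((W.baseChange (((primesEquiv (R := 𝓞 ℚ)).symm ⟨p, hp.out⟩).adicCompletion ℚ)).localTamagawaNumber
        (((primesEquiv (R := 𝓞 ℚ)).symm ⟨p, hp.out⟩).adicCompletionIntegers ℚ)) = 0)
    (hp2 : p ≠ 2) :
    ∀ (W : WeierstrassCurve ℚ) [W.IsElliptic] [W.IsGloballyMinimal],
      HasSignedLocalType W p (.Istar 0) → W.analyticRank = 1 →
      ∀ (V : WeierstrassCurve ℚ) [V.IsElliptic] [V.IsGloballyMinimal] (C : VariableChange ℚ)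
        {N : ℕ} [NeZero N] {f : CuspForm (Gamma0 N) 2},
        C • W.quadraticTwist ((-1) ^ (p / 2) * p) = V →
        V.HasGoodReductionAtPrime p → V.frobeniusTrace p = 0 → IsNewformOf V f →
        ∀ (ϖ : ℚ), (if Even (p / 2) then (ϖ : ℝ) * V.realPeriodRat = plusPeriod f
            else (ϖ : ℝ) * V.imaginaryPeriodRat = minusPeriod f) →
        ∀ (L : IwasawaAlgebra p), IsQuadraticBranchMinusLFunction f p ϖ L →
        (∀ Q : (W.baseChange ℚ_[p]).toAffine.Point, p • Q = 0 → Q = 0) →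
        ∀ (P : W.toAffine.Point) (n : ℕ), ¬ IsOfFinAddOrder P →
        (∀ R : W.toAffine.Point, ∃ (k : ℤ) (T : W.toAffine.Point), IsOfFinAddOrder T ∧ R = k • P + T) →
        (∃ Q : (W.baseChange ℚ_[p]).toAffine.Point, p ^ n • Q = W.toPadicPoint p P) →
        (∀ Q : (W.baseChange ℚ_[p]).toAffine.Point, p ^ (n + 1) • Q ≠ W.toPadicPoint p P) →
        ∀ (q : ℚ), shaAn W = (q : ℂ) →
        PowerSeries.coeff 1 L ≠ 0 ∧
          ((PowerSeries.coeff 1 L : ℤ_[p]) : ℚ_[p]).valuation =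
            2 * (n : ℤ) + padicValRat p (q * W.tamagawaProduct / (W.torsionOrder : ℚ) ^ 2) := by
  -- bsd-cm-inert's inline step (InertBadOdd.missingInputAt_IstarZero_of_etaGZValuation_of_readings_of_ne_two)
  intro W _ _ hT hr V _ _ C N _ f hCV hgood hap hf ϖ hϖ L hL htors P n hP hgen hdiv hndiv q hq
  have hq' := leadingTerm_eq_of_shaAn_eq W hq
  obtain ⟨hne, hv⟩ := hGZ W hT hr V C hCV hgood hap hf ϖ hϖ L hL P hP hgen _ hq'
  have hcp' : ¬ p ∣ (W.baseChange ℚ_[p]).localTamagawaNumber ℤ_[p] := by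
    rw [localTamagawaNumber_padic_eq_holds W ((primesEquiv (R := 𝓞 ℚ)).symm ⟨p, hp.out⟩) p
      (by rw [Equiv.apply_symm_apply])]
    intro h
    have h0 := hcp W hT
    rw [padicValNat.eq_zero_iff] at h0
    rcases h0 with h1 | h0 | hnd
    · exact hp.out.one_lt.ne' h1
    · exact localTamagawaNumber_adicCompletion_ne_zero W _ h0
    · exact hnd h
  obtain ⟨-, hlev⟩ := valuation_padicLog_eq_level W p
    (addv_of_hasSignedLocalType_of_twist_good W hT hp2 C hCV hgood) hcp' htors hdiv hndiv
  rw [hlev] at hv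
  exact ⟨hne, hv⟩

/-- **THE D71 CHILD `InertBadAtThreeIstarZero` MODULO (GZ_η-VAL)@3 (print/LOG normal form) ∧ `hC1K₃`
(Kobayashi's even main conjecture at `η` for CM curves at `p = 3`, ONE verbatim form) ∧ the NAMED
facts KO18 Main Thm. 1.3 / Kob03 Thm. 7.4 (η) ∧ `PublishedFactsInert`** — §2 with the law displayed
in print currency (`hGZη₃`: `coeff₁ L ≠ 0 ∧ v₃(coeff₁ L) = 2·ord₃ log_ω(P) + ord₃(L′(W,1)/(Ω_W·Reg W))`
on the type; the cell's own statement, PAPER from (GZ_η)@3 by memo N21 v1.2 — NO print; a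
HYPOTHESIS), converted by `pairLaw_of_etaGZValuation_of_ne_two`. CONDITIONAL on every displayed
hypothesis; the item stays OPEN; nothing booked. [cite: Kobayashi2003, §4 (p. 8), Thm. 7.4 (p. 13)]
[cite: KitajimaOtsuki2018, Main Thm. 1.3] [cite: PollackRubin2004, p. 448 (remark)]
[cite: Mazur1978, Cor. 4.1] [cite: SilvermanAEC2009, IV.6.4 and VII.6.3]
[cite: SilvermanATAEC1994, IV.9.4 and Table 4.1] [cite: Miller2011LMS, §1 and Def. 1.1] -/
theorem inertBadAtThreeIstarZero_of_etaGZValuationAtThree_of_kobayashi74_of_plusMCEtaK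
    (hGZη₃ : ∀ (W : WeierstrassCurve ℚ) [W.IsElliptic] [W.IsGloballyMinimal],
      HasSignedLocalType W 3 (.Istar 0) → W.analyticRank = 1 →
      ∀ (V : WeierstrassCurve ℚ) [V.IsElliptic] [V.IsGloballyMinimal] (C : VariableChange ℚ)
        {N : ℕ} [NeZero N] {f : CuspForm (Gamma0 N) 2},
        C • W.quadraticTwist (-3) = V →
        V.HasGoodReductionAtPrime 3 → V.frobeniusTrace 3 = 0 → IsNewformOf V f →
        ∀ (ϖ : ℚ), (ϖ : ℝ) * V.imaginaryPeriodRat = minusPeriod f →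
        ∀ (L : IwasawaAlgebra 3), IsQuadraticBranchMinusLFunction f 3 ϖ L →
        ∀ (P : W.toAffine.Point), ¬ IsOfFinAddOrder P →
        (∀ R : W.toAffine.Point, ∃ (k : ℤ) (T : W.toAffine.Point), IsOfFinAddOrder T ∧ R = k • P + T) →
        ∀ (q : ℚ), W.leadingLCoeff / ((W.realPeriodRat * W.regulator : ℝ) : ℂ) = (q : ℂ) →
        PowerSeries.coeff 1 L ≠ 0 ∧
          ((PowerSeries.coeff 1 L : ℤ_[3]) : ℚ_[3]).valuation =
            2 * (padicLog (W.baseChange ℚ_[3]) (W.toPadicPoint 3 P)).valuation + padicValRat 3 q)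
    (hC1K₃ : ∀ (K₀ : Type) [Field K₀] [NumberField K₀] [IsCyclotomicExtension {3} ℚ K₀]
        [(galRange (K := ℚ) K₀).Normal] (ηχ : absoluteGaloisGroup ℚ →* ℤˣ),
        (∀ σ ∈ galRange (K := ℚ) K₀, ηχ σ = 1) → ηχ ≠ 1 →
      ∀ (V : WeierstrassCurve ℚ) [V.IsElliptic] [V.IsGloballyMinimal] {N : ℕ} [NeZero N]
        {f : CuspForm (Gamma0 N) 2}, V.HasCM →
        (3 : ℕ) ≠ 2 → V.HasGoodReductionAtPrime 3 → V.frobeniusTrace 3 = 0 → IsNewformOf V f →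
      ∀ (ϖ : ℚ), (ϖ : ℝ) * V.imaginaryPeriodRat = minusPeriod f →
      ∀ (κ : ZpExtension ℚ 3) (γ : absoluteGaloisGroup ℚ),
        κ.IsCyclotomic → κ.IsTopGenerator γ → γ ∈ galRange (K := ℚ) K₀ → IsCyclotomicVariable 3 γ →
      ∀ (Lp : IwasawaAlgebra 3), Additive.IsQuadraticBranchPlusLFunction f 3 ϖ Lp →
      ∀ D : Additive.EtaSignedSelmerDualData V κ K₀ ℚ_[3] ηχ γ 1, D.charIdeal = Ideal.span {Lp})
    (hKO : KitajimaOtsuki2018.mainThm13_etaSignedSelmerDual_noFiniteSubmodule)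
    (h74 : Kobayashi2003.thm74_etaEvenMC_iff_etaOddMC) (h₆ : PublishedFactsInert) :
    Summit.BirchSwinnertonDyer.BirchSwinnertonDyer.Theses.InertBadSignedBranches.InertBadAtThreeIstarZero := by
  unfold Summit.BirchSwinnertonDyer.BirchSwinnertonDyer.Theses.InertBadSignedBranches.InertBadAtThreeIstarZero
  obtain ⟨hmod, hGZ, hGZK, hPT, hnf, hM⟩ := h₆
  have h32 : ((-1 : ℚ) ^ (3 / 2) * (3 : ℕ)) = -3 := by norm_num
  have hodd : ¬ Even (3 / 2) := by decide
  intro W _ _ h3 hT hr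
  have hcp : ∀ (X : WeierstrassCurve ℚ) [X.IsElliptic] [X.IsGloballyMinimal],
      HasSignedLocalType X 3 (.Istar 0) →
      padicValNat 3 ((X.baseChange (((primesEquiv (R := 𝓞 ℚ)).symm ⟨3, h3.out⟩).adicCompletion
        ℚ)).localTamagawaNumber (((primesEquiv (R := 𝓞 ℚ)).symm ⟨3, h3.out⟩).adicCompletionIntegers
        ℚ)) = 0 :=
    fun X _ _ hX ↦ padicValNat_localTamagawaNumber_eq_zero_of_hasCM_three X hX.1
      (not_cmRamified_of_hasSignedLocalType X 3 hX)
  refine missingInputAt_IstarZero_of_pairLaw_of_kobayashi74_of_plusMCEtaK_of_ne_two 3 hmod hGZ hGZK hPT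
    hnf hM hKO h74 ?_ (pairLaw_of_etaGZValuation_of_ne_two 3 ?_ hcp (by decide)) (by decide) W hT hr
  · intro K₀ _ _ _ _ ηχ hηK hη1 V _ _ N _ f hCM hp2 hgood hap hf ϖ hϖ κ γ hκ hγ hγK hγc Lp hLp D
    rw [if_neg hodd] at hϖ
    exact hC1K₃ K₀ ηχ hηK hη1 V hCM hp2 hgood hap hf ϖ hϖ κ γ hκ hγ hγK hγc Lp hLp D
  · intro W _ _ hT hr V _ _ C N _ f hC hgood hap hf ϖ hϖ L hL P hP hgen q hq
    rw [h32] at hC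
    rw [if_neg hodd] at hϖ
    exact hGZη₃ W hT hr V C hC hgood hap hf ϖ hϖ L hL P hP hgen q hq
end Summit.BirchSwinnertonDyer.BirchSwinnertonDyer.Theorems.InertBadOddEta
end
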